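import Literature.Barriers.HubbardSuperconductivity.StrongCouplingCeilingAtomicLimit
import Literature.MathematicalPhysics.QuantumLattice.HubbardLatticeAnalytic
import HarnessLib

/-!
# Discharge of the barrier `StrongCouplingCeiling` (Ueltschi 1999, Theorem 3.1 on `D₁` via Theorem 2.1 (i))

Sibling proof file of `Literature/Barriers/HubbardSuperconductivity/StrongCouplingCeiling.lean`:
`theorem StrongCouplingCeiling_holds : StrongCouplingCeiling`, with the (non-optimised) constant
`ε = τ₀ = (4 e⁶ · 2178)⁻¹` (`HubbardLatticeActivity.tau0`). The proof is the cluster expansion of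
Ueltschi's §2.3/§3, assembled from the tree:

1. **polymer representation** of the box partition function (free boundary conditions) around the
   atomic limit, `Z_{Λ_L} = z₀^{|Λ_L|} Ξ_{𝒫(box 2 L)}(ρ_{β,μ})`, with the translation-invariant
   lattice activity `ρ = latticeActivity 2 β U μ (βt)` (`partitionFn_box_eq`; the fermionic
   bookkeeping is `FermionTraceFactorization` / `FermionEmbedding` / `HubbardBondAlgebra` /
   `HubbardPolymerRepresentation`);
2. **smallness** `IsSmallTIActivity ρ 1` for `βt < τ₀`, UNIFORMLY in `U` (`HubbardPolymerBounds`,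
   `HubbardLatticeActivity`: the per-site factor `‖e^{-βV}‖/|z₀|` is `1` at real parameters);
3. the **Kotecký–Preiss theorem** (`ClusterExpansionKPBound`, the discharged estimate (4)) and
   the **thermodynamic limit of the polymer pressure** along boxes (`PolymerPressure`):
   `f_L = -β⁻¹ (log z₀ + Re (log Ξ_L / |Λ_L|)) → -β⁻¹ (log z₀ + Re p)` (`boxFreeEnergy_eq`,
   `tendsto_boxFreeEnergy`), so `freeEnergy = -β⁻¹ (log z₀ + Re p)` (`freeEnergy_eq`);
4. **analyticity** in `(β, μ)`: the pressure `p` of the holomorphic family of small activities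
   is analytic on the admissible complex domain (`HubbardLatticeAnalytic`,
   `PolymerPressureAnalytic` = several-variable Vitali/Weierstrass, `LocallyUniformLimitSCV`),
   and the real free energy is, near every real point of `D₁`, the real-analytic function
   `-β⁻¹ (log z₀(β, U, μ) + Re p(β, μ))` (`analyticAt_freeEnergy`).

Everything is PROVED; no statement of the barrier file is changed.

## References

* D. Ueltschi, J. Stat. Phys. 95 (1999) 693, Theorem 2.1 (i), Proposition 2.2, §2.3, Theorem
  3.1. [Ueltschi1999]
* R. Kotecký, D. Preiss, Comm. Math. Phys. 103 (1986) 491. [KoteckyPreiss1986]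
-/

noncomputable section

namespace Literature.Barriers.HubbardSuperconductivity

open Filter Literature.MathematicalPhysics.QuantumLattice Literature.Probability.LatticeModels
open scoped _root_.Topology

/-- The lattice activity of the Hubbard model on `ℤ²` at real parameters, as a function of
`(β, μ)` (fixed `t`, `U`): `ρ_{β,μ} = latticeActivity 2 β U μ (βt)`. [cite: Ueltschi1999, §2.3 and §3 (weights ρ(𝒜))] -/
def rho (t U β μ : ℝ) : Finset (Site 2) → ℂ :=
  latticeActivity 2 (β : ℂ) (U : ℂ) (μ : ℂ) ((β : ℂ) * (t : ℂ))

/-- The candidate infinite-volume free energy: `-β⁻¹ (log z₀(β,U,μ) + Re p(ρ_{β,μ}))`.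
[cite: Ueltschi1999, proof of Theorem 2.1 (i) (f(β,μ) = f₀(β,μ) - β⁻¹ Σ_C Φ^T(C)/|C|)] -/
def freeEnergyLimit (t U μ β : ℝ) : ℝ :=
  -β⁻¹ * (Real.log (atomicPartitionFnReal β U μ) + (polymerPressure (rho t U β μ)).re)

variable {t U μ β : ℝ}

/-- In `D₁` the lattice activity is a small translation-invariant activity (`δ = 1`).
[cite: Ueltschi1999, Theorem 3.1 (domain D₁) via Proposition 2.2] -/
theorem isSmallTIActivity_rho (ht : 0 ≤ t) (hβ : 0 ≤ β) (hβt : β * t < tau0) (U μ : ℝ) :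
    IsSmallTIActivity (rho t U β μ) 1 := by
  have h := isSmallTIActivity_of_mem_admissibleSet (z := ((β : ℂ), (μ : ℂ))) ht
    (mem_admissibleSet_of_real (U := U) μ hβ hβt)
  dsimp only at h
  exact h

/-- The scaled activities `s ρ`, `0 ≤ s ≤ 1`, are small as well (used for the zero-freeness
along the ray defining the Kotecký–Preiss logarithm). [folklore] -/
theorem isSmallTIActivity_smul {ρ : Finset (Site 2) → ℂ} (h : IsSmallTIActivity ρ 1) {s : ℝ} (hs : s ∈ Set.Icc (0 : ℝ) 1) :
    IsSmallTIActivity (fun A => (s : ℂ) * ρ A) 1 where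
  shift_invariant v A := by rw [h.shift_invariant v A]
  eq_zero_of_not_isRConnected A hA := by rw [h.eq_zero_of_not_isRConnected A hA, mul_zero]
  delta_pos := one_pos
  sum_le_one x 𝒜 h𝒜 := by
    refine le_trans (Finset.sum_le_sum fun A _ => ?_) (h.sum_le_one x 𝒜 h𝒜)
    refine mul_le_mul_of_nonneg_right ?_ (Real.exp_nonneg _)
    rw [norm_mul, Complex.norm_real, Real.norm_eq_abs, abs_of_nonneg hs.1]
    exact mul_le_of_le_one_left (norm_nonneg _) hs.2

/-- The lattice activity at real parameters is real. [folklore] -/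
theorem rho_im_eq_zero (t U β μ : ℝ) (A : Finset (Site 2)) : (rho t U β μ A).im = 0 := by
  unfold rho
  rw [← Complex.ofReal_mul]
  exact latticeActivity_im_eq_zero β U μ (β * t) A

/-- **The finite-volume free energy through the cluster expansion**: in `D₁`,
`f_L(t,U,μ,β) = -β⁻¹ (log z₀ + Re (log Ξ_L / |Λ_L|))` with the Kotecký–Preiss logarithm
`log Ξ_L = polymerLogZ` of the polymer gas in the box. [cite: Ueltschi1999, proof of Theorem 2.1 (i) (Tr e^{-βH_Λ} = e^{-βf₀|Λ|} Σ Π ρ; log by Proposition 2.2)] -/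
theorem boxFreeEnergy_eq (ht : 0 ≤ t) (hβ : 0 < β) (hβt : β * t < tau0) (U μ : ℝ) (L : ℕ) :
    boxFreeEnergy t U μ β L =
      -β⁻¹ * (Real.log (atomicPartitionFnReal β U μ) +
        (polymerLogZ polyInc (rho t U β μ) (box 2 L).powerset / ((box 2 L).card : ℂ)).re) := by
  have hsm := isSmallTIActivity_rho ht hβ.le hβt U μ
  set Ξ := polymerPartitionFunction polyInc (rho t U β μ) (box 2 L).powerset with hΞ
  -- the KP logarithm is the real logarithm of `Ξ > 0`
  have hZ : ∀ s ∈ Set.Icc (0 : ℝ) 1, polymerPartitionFunction polyInc (fun A => (s : ℂ) * rho t U β μ A) (box 2 L).powerset ≠ 0 :=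
    fun s hs => polymerPartitionFunction_ne_zero_of_kp ((isSmallTIActivity_smul hsm hs).isKPVolume _) Finset.Subset.rfl
  obtain ⟨hΞpos, hlog⟩ := polymerLogZ_eq_log_of_real (inc := polyInc) (rho_im_eq_zero t U β μ) hZ
  -- the partition function of the box
  have hZbox : (hamiltonianWith (fermionBoxGraph 2 L) t U μ).partitionFn β =
      (((atomicPartitionFnReal β U μ ^ Fintype.card (FermionBox 2 L) * Ξ.re : ℝ)) : ℂ) := by
    have h : (hamiltonianWith (fermionBoxGraph 2 L) t U μ).partitionFn β =
        atomicPartitionFn β U μ ^ Fintype.card (FermionBox 2 L) * Ξ :=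
      partitionFn_box_eq (d := 2) β t U μ L
    rw [atomicPartitionFn_ofReal] at h
    have hΞre : Ξ = ((Ξ.re : ℝ) : ℂ) := by
      apply Complex.ext
      · simp
      · rw [Complex.ofReal_im]
        exact polymerPartitionFunction_im_eq_zero (inc := polyInc) (rho_im_eq_zero t U β μ) _
    rw [h]
    push_cast
    rw [← hΞre]
  have hz0 : 0 < atomicPartitionFnReal β U μ := atomicPartitionFnReal_pos β U μ
  have hN : Fintype.card (FermionBox 2 L) = (box 2 L).card := by rw [card_fermionBox_two, card_box]
  have hNpos : (0 : ℝ) < (box 2 L).card := by rw [card_box]; positivity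
  rw [boxFreeEnergy_def, hZbox, Complex.ofReal_re, Real.log_mul (pow_pos hz0 _).ne' hΞpos.ne', Real.log_pow, hlog, hN,
    ← Complex.ofReal_natCast, ← Complex.ofReal_div, Complex.ofReal_re]
  field_simp

/-- **Thermodynamic limit in `D₁`**: `f_L → -β⁻¹ (log z₀ + Re p(ρ_{β,μ}))`. [cite: Ueltschi1999, Theorem 3.1 with Theorem 2.1 (i) (existence of the free energy)] -/
theorem tendsto_boxFreeEnergy (ht : 0 ≤ t) (hβ : 0 < β) (hβt : β * t < tau0) (U μ : ℝ) :
    Tendsto (fun L : ℕ => boxFreeEnergy t U μ β L) atTop (𝓝 (freeEnergyLimit t U μ β)) := by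
  have hsm := isSmallTIActivity_rho ht hβ.le hβt U μ
  have hlim := hsm.tendsto_polymerLogZ_box_div_card (by norm_num : 1 ≤ 2)
  have hre := (Complex.continuous_re.tendsto _).comp hlim
  rw [show (fun L : ℕ => boxFreeEnergy t U μ β L) = fun L => -β⁻¹ * (Real.log (atomicPartitionFnReal β U μ) +
      (polymerLogZ polyInc (rho t U β μ) (box 2 L).powerset / ((box 2 L).card : ℂ)).re) from
    funext fun L => boxFreeEnergy_eq ht hβ hβt U μ L]
  exact (tendsto_const_nhds.add hre).const_mul _

/-- **The free energy in `D₁`** is `-β⁻¹ (log z₀(β,U,μ) + Re p(ρ_{β,μ}))`. [cite: Ueltschi1999, proof of Theorem 2.1 (i) (formula for f(β, μ))] -/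
theorem freeEnergy_eq (ht : 0 ≤ t) (hβ : 0 < β) (hβt : β * t < tau0) (U μ : ℝ) :
    freeEnergy t U μ β = freeEnergyLimit t U μ β :=
  (tendsto_boxFreeEnergy ht hβ hβt U μ).limUnder_eq

/-- **Real-analyticity of the free energy in `(β, μ)` in `D₁`.** [cite: Ueltschi1999, Theorem 3.1 with Theorem 2.1 (i) ("analytic in β and μ")] -/
theorem analyticAt_freeEnergy (ht : 0 ≤ t) (hβ : 0 < β) (hβt : β * t < tau0) (U μ : ℝ) :
    AnalyticAt ℝ (fun p : ℝ × ℝ => freeEnergy t U p.2 p.1) (β, μ) := by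
  -- the complex pressure and the real inclusion
  set P : ℂ × ℂ → ℂ := fun z => polymerPressure (latticeActivity 2 z.1 U z.2 (z.1 * t)) with hP
  set ι : ℝ × ℝ →L[ℝ] ℂ × ℂ :=
    (Complex.ofRealCLM.comp (ContinuousLinearMap.fst ℝ ℝ ℝ)).prod (Complex.ofRealCLM.comp (ContinuousLinearMap.snd ℝ ℝ ℝ)) with hι
  have hιapp : ∀ q : ℝ × ℝ, ι q = ((q.1 : ℂ), (q.2 : ℂ)) := fun q => rfl
  have hPa : AnalyticAt ℂ P (ι (β, μ)) := by
    rw [hιapp]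
    exact analyticOnNhd_polymerPressure_lattice (U := U) ht _ (mem_admissibleSet_of_real μ hβ.le hβt)
  have hPι : AnalyticAt ℝ (fun q : ℝ × ℝ => P (ι q)) (β, μ) :=
    AnalyticAt.comp (f := fun q : ℝ × ℝ => ι q) (x := (β, μ)) (hPa.restrictScalars (𝕜 := ℝ)) (ι.analyticAt _)
  have hRe : AnalyticAt ℝ (fun q : ℝ × ℝ => (P (ι q)).re) (β, μ) :=
    AnalyticAt.comp (f := fun q : ℝ × ℝ => P (ι q)) (x := (β, μ)) (Complex.reCLM.analyticAt _) hPι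
  -- the explicit formula is analytic
  have hF : AnalyticAt ℝ (fun q : ℝ × ℝ => -q.1⁻¹ * (Real.log (atomicPartitionFnReal q.1 U q.2) + (P (ι q)).re)) (β, μ) := by
    have h1 : AnalyticAt ℝ (fun q : ℝ × ℝ => q.1⁻¹) (β, μ) := analyticAt_fst.inv hβ.ne'
    have h2 : AnalyticAt ℝ (Real.log ∘ fun q : ℝ × ℝ => atomicPartitionFnReal q.1 U q.2) (β, μ) :=
      AnalyticAt.comp (f := fun q : ℝ × ℝ => atomicPartitionFnReal q.1 U q.2) (x := (β, μ))
        (analyticAt_log (atomicPartitionFnReal_pos β U μ)) (analyticAt_atomicPartitionFnReal U _)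
    exact h1.neg.mul (h2.add hRe)
  -- and agrees with the free energy near `(β, μ)`
  refine hF.congr ?_
  have hS : IsOpen ({q : ℝ × ℝ | 0 < q.1} ∩ {q : ℝ × ℝ | q.1 * t < tau0}) :=
    (isOpen_lt continuous_const continuous_fst).inter
      (isOpen_lt (continuous_fst.mul continuous_const) continuous_const)
  filter_upwards [hS.mem_nhds ⟨hβ, hβt⟩] with q hq
  rw [freeEnergy_eq ht hq.1 hq.2 U q.2, freeEnergyLimit]
  rfl

/-- **Discharge of the barrier `StrongCouplingCeiling`** (Ueltschi 1999, Theorem 3.1 on `D₁`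
via Theorem 2.1 (i), square lattice, free boundary conditions), with `ε = τ₀ = (4e⁶ · 2178)⁻¹`:
for `t, U ≥ 0`, `β > 0`, `βt < ε` and every `μ`, the free energy density has a thermodynamic
limit along `{-L,…,L}²` and is jointly real-analytic in `(β, μ)` — uniformly in `U`.
[cite: Ueltschi1999, Theorem 3.1 (domain D₁) with Theorem 2.1 (i)] -/
theorem StrongCouplingCeiling_holds : StrongCouplingCeiling := by
  refine ⟨tau0, tau0_pos, fun t U μ β ht _ hβ hβt => ⟨?_, analyticAt_freeEnergy ht hβ hβt U μ⟩⟩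
  rw [freeEnergy_eq ht hβ hβt U μ]
  exact tendsto_boxFreeEnergy ht hβ hβt U μ

end Literature.Barriers.HubbardSuperconductivity

end
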